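import Summits.RiemannHypothesis.RiemannHypothesis.Theorems.WeilWindowFlowGronwallLeakageIffRH
import Summits.RiemannHypothesis.RiemannHypothesis.Theorems.GronwallLeakage.Negative.LoadBearing
import Literature.NumberTheory.LFunctions.WeilExplicitProofs
import Literature.NumberTheory.LFunctions.WeilExplicitFormulaProofs
import Literature.NumberTheory.LFunctions.WeilZeroSum
import Literature.NumberTheory.LFunctions.WeilMellinBounds
import Literature.NumberTheory.LFunctions.WeilDilationVirial
import Literature.NumberTheory.LFunctions.WeilGroundState
import Literature.NumberTheory.LFunctions.WeilGroundEnergyProofs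
import Literature.NumberTheory.LFunctions.ZetaFirstZeroCertificate
import HarnessLib
import Summits.RiemannHypothesis.RiemannHypothesis.Theorems.WeilRouteProps.WeilWindowFlow

/-!
# Tightness of `GronwallLeakage` at `+∞`: the window bottom is not bounded away from `0`
(crux stmt-RiemannHypothesis-1037, route WeilWindowFlow; line `Sketch`, lead continuation c5)

`ε := weilGroundEnergy`. The standing disprover's file `Cruxes/GronwallLeakage/Disproof.lean` §6 left
ONE `sorry`, the RH branch of "the bottom is not uniformly positive"
(`bottom_not_uniformly_positive_under_RH`), sketched there through simultaneous Dirichlet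
approximation of the zeta ordinates. This file closes it by a much shorter route and records the
consequences for the crux:

* `re_weilQuadratic_le_of_RH` — under RH, `Re Q(g) ≤ K · Σ_ρ m(ρ)/(1+γ²)²` as soon as
  `|ĝ(ρ)|² ≤ K/(1+γ²)²` on the non-trivial zeros (explicit formula `explicit_formula_holds`, every
  term of the zero side being `m(ρ)|ĝ(ρ)|² ≥ 0` on the critical line, and the unconditional
  summability `weilZeroSummable`).
* `weilGroundEnergy_le_div_cube_of_RH` — under RH, `ε(a) ≤ M/a³` for `a ≥ 1`: test the window
  `[-a, a]` with the unitary dilate `g_a(t) = a^{-1/2} φ(t/a)` of a fixed bump `φ` on `[-1, 1]`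
  (`weilDilate`); two integrations by parts on the critical line (`weilMellin_deriv_deriv`) give
  `|ĝ_a(1/2+iγ)| ≤ a^{-3/2} ‖φ''‖₁/γ²`, and the zeros have `|γ| > 14 ≥ 1`
  (`riemannZeta_ne_zero_of_im_pos_of_im_le_fourteen`), so `|ĝ_a(ρ)|² ≤ 4 a^{-3} ‖φ''‖₁²/(1+γ²)²`.
  Low frequencies carry no zeros: a wide bump sees almost nothing of the zero side.
* `tendsto_weilGroundEnergy_atTop_of_RH` — under RH, `ε(a) → 0` as `a → +∞`;
  `weilGroundEnergy_not_uniformly_positive` — UNCONDITIONALLY `∀ δ > 0, ∃ a > 0, ε(a) < δ`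
  (RH branch above, `¬RH` branch `exists_weilGroundEnergy_neg_of_not_riemannHypothesis`).
* `gronwallLeakage_rate_integral_tendsto_atTop` — TIGHTNESS OF THE CRUX AT `+∞`: for every
  witness rate `C` of `GronwallLeakage` and every `b > 0`, `∫_b^a C → +∞` as `a → +∞`. Together with
  the landed tightness at `0⁺` (`gronwallLeakage_rate_not_intervalIntegrable_from_zero`,
  `Negative/LoadBearing.lean`): an admissible rate is integrable on NO neighbourhood of either end of
  `(0, ∞)`; in particular `GronwallLeakage` with `C ∈ L¹(b, ∞)` is false
  (`gronwallLeakage_false_with_rate_integrable_at_top`).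

Helpers `--supports stmt-RiemannHypothesis-1037`; nothing here is a new definition or a cited fact
(all inputs are tree theorems). Axioms ⊆ {propext, Classical.choice, Quot.sound}.
-/

-- `Summit.RiemannHypothesis.RiemannHypothesis.…` repeats a namespace component by design (D-0017 layout).
set_option linter.dupNamespace false

noncomputable section

namespace Summit.RiemannHypothesis.RiemannHypothesis.Theorems.WeilWindowFlowGronwallLeakage

open Complex Filter Set MeasureTheory
open scoped Real Topology ComplexConjugate
open Literature.NumberTheory.LFunctions
open Summit.RiemannHypothesis.RiemannHypothesis.Theorems.WeilRouteProps.WeilWindowFlow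
open Summit.RiemannHypothesis.Cruxes.GronwallLeakage.Negative

/-! ## Transform bounds on the critical line -/

/-- On the critical line the transform is bounded by the plain `L¹` norm:
`‖ĥ(1/2 + iu)‖ ≤ ∫ ‖h‖` (the kernel `e^{iut}` is unimodular). [folklore] -/
theorem norm_weilMellin_half_line_le (h : ℝ → ℂ) (u : ℝ) :
    ‖weilMellin h (1 / 2 + u * I)‖ ≤ ∫ t : ℝ, ‖h t‖ := by
  unfold weilMellin
  refine (norm_integral_le_integral_norm _).trans_eq ?_
  congr 1 with t
  have e : (1 / 2 + (u : ℂ) * I - 1 / 2) * (t : ℂ) = ((u * t : ℝ) : ℂ) * I := by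
    push_cast
    ring
  rw [norm_mul, e, Complex.norm_exp_ofReal_mul_I, mul_one]

/-- Two integrations by parts on the critical line: `u² ‖φ̂(1/2 + iu)‖ ≤ ∫ ‖φ''‖` for a test
function `φ` (`weilMellin_deriv_deriv`). [folklore] -/
theorem sq_mul_norm_weilMellin_half_line_le {φ : ℝ → ℂ} (hφ : IsWeilTest φ) (u : ℝ) :
    u ^ 2 * ‖weilMellin φ (1 / 2 + u * I)‖ ≤ ∫ t : ℝ, ‖deriv (deriv φ) t‖ := by
  have h := norm_weilMellin_half_line_le (deriv (deriv φ)) u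
  rw [weilMellin_deriv_deriv hφ, norm_mul] at h
  have e : ‖(1 / 2 + (u : ℂ) * I - 1 / 2) ^ 2‖ = u ^ 2 := by
    have h1 : (1 / 2 + (u : ℂ) * I - 1 / 2) ^ 2 = -((u : ℂ) ^ 2) := by
      have h2 : (1 / 2 + (u : ℂ) * I - 1 / 2) = u * I := by ring
      rw [h2, mul_pow, Complex.I_sq]
      ring
    rw [h1, norm_neg, norm_pow, Complex.norm_real, Real.norm_eq_abs, sq_abs]
  rwa [e] at h

/-! ## The zero side under RH: an upper bound for `Re Q(g)` -/

/-- **Upper bound for Weil's form through the zero side (under RH).** If `|ĝ(ρ)|² ≤ K/(1+γ²)²` at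
every non-trivial zero `ρ = 1/2 + iγ` then `Re Q(g) ≤ K · Σ_ρ m(ρ)/(1+γ²)²`: by the explicit formula
(`explicit_formula_holds`) `Re Q(g)` is the limit of the truncated zero sides, whose terms are
`m(ρ)|ĝ(ρ)|²` on the critical line (`weilMellin_weilQuadratic_of_re_eq`), and the weights
`m(ρ)/(1+γ²)²` are summable unconditionally (`weilZeroSummable`). (Bombieri 2000 §3, (3.2).) [folklore] -/
theorem re_weilQuadratic_le_of_RH (hRH : _root_.RiemannHypothesis) {g : ℝ → ℂ} (hg : IsWeilTest g)
    {K : ℝ} (hK : 0 ≤ K)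
    (hb : ∀ ρ ∈ ZetaZeros.riemannZetaNontrivialZeros,
      Complex.normSq (weilMellin g ρ) ≤ K / (1 + ρ.im ^ 2) ^ 2) :
    (weilQuadratic g).re ≤
      K * ∑' ρ : ZetaZeros.riemannZetaNontrivialZeros, weilZeroWeight (ρ : ℂ) := by
  classical
  have hk : IsWeilTest (weilConv g (weilReflect g)) := hg.weilConv hg.weilReflect
  have hlim : Tendsto (fun T ↦ (weilZeroSidePartial (weilConv g (weilReflect g)) T).re) atTop
      (𝓝 (weilQuadratic g).re) :=
    (Complex.continuous_re.tendsto _).comp (explicit_formula_holds hk)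
  refine le_of_tendsto' hlim fun T ↦ ?_
  rw [weilZeroSidePartial_eq_sum, Complex.re_sum]
  have hterm : ∀ ρ ∈ weilZeroFinset T,
      ((riemannZetaZeroOrder (ρ : ℂ) : ℂ) * weilMellin (weilConv g (weilReflect g)) ρ).re ≤
        K * weilZeroWeight (ρ : ℂ) := by
    intro ρ _
    have hζ := ZetaZeros.riemannZetaNontrivialZeros.zeta_eq_zero ρ.2
    have him := ZetaZeros.riemannZetaNontrivialZeros.im_ne_zero ρ.2
    have hne := ZetaZeros.riemannZetaNontrivialZeros.ne_one ρ.2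
    have hre : (ρ : ℂ).re = 1 / 2 := WeilWindowFlowStrictUnderRH.re_eq_half_of_RH hRH hζ him
    rw [weilMellin_weilQuadratic_of_re_eq hg hre, ← Complex.ofReal_intCast, ← Complex.ofReal_mul,
      Complex.ofReal_re]
    have hm : (0 : ℝ) ≤ riemannZetaZeroOrder (ρ : ℂ) := by
      exact_mod_cast riemannZetaZeroOrder_nonneg hne
    calc (riemannZetaZeroOrder (ρ : ℂ) : ℝ) * Complex.normSq (weilMellin g ρ)
        ≤ (riemannZetaZeroOrder (ρ : ℂ) : ℝ) * (K / (1 + (ρ : ℂ).im ^ 2) ^ 2) :=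
          mul_le_mul_of_nonneg_left (hb ρ ρ.2) hm
      _ = K * weilZeroWeight (ρ : ℂ) := by
          unfold weilZeroWeight
          ring
  calc ∑ ρ ∈ weilZeroFinset T,
        ((riemannZetaZeroOrder (ρ : ℂ) : ℂ) * weilMellin (weilConv g (weilReflect g)) ρ).re
      ≤ ∑ ρ ∈ weilZeroFinset T, K * weilZeroWeight (ρ : ℂ) := Finset.sum_le_sum hterm
    _ = K * ∑ ρ ∈ weilZeroFinset T, weilZeroWeight (ρ : ℂ) := (Finset.mul_sum _ _ _).symm
    _ ≤ K * ∑' ρ : ZetaZeros.riemannZetaNontrivialZeros, weilZeroWeight (ρ : ℂ) :=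
        mul_le_mul_of_nonneg_left
          (weilZeroSummable.sum_le_tsum _ fun ρ _ ↦ weilZeroWeight_nonneg ρ.2) hK

/-- **No low zeros**: every non-trivial zero has `|Im ρ| ≥ 1` (indeed `> 14`:
`riemannZeta_ne_zero_of_im_pos_of_im_le_fourteen`, the tree's certified `N(14) = 0`, plus the
conjugation symmetry of the zeros). [folklore] -/
theorem one_le_abs_im_of_mem_nontrivialZeros {ρ : ℂ}
    (h : ρ ∈ ZetaZeros.riemannZetaNontrivialZeros) : 1 ≤ |ρ.im| := by
  by_contra hlt
  rw [not_le] at hlt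
  have him := ZetaZeros.riemannZetaNontrivialZeros.im_ne_zero h
  rcases lt_or_gt_of_ne him with hneg | hpos
  · have h' := ZetaZeros.riemannZetaNontrivialZeros.conj_mem h
    have habs : |ρ.im| = -ρ.im := abs_of_neg hneg
    refine riemannZeta_ne_zero_of_im_pos_of_im_le_fourteen (s := conj ρ) ?_ ?_
      (ZetaZeros.riemannZetaNontrivialZeros.zeta_eq_zero h')
    · rw [Complex.conj_im]
      linarith
    · rw [Complex.conj_im]
      linarith
  · have habs : |ρ.im| = ρ.im := abs_of_pos hpos
    exact riemannZeta_ne_zero_of_im_pos_of_im_le_fourteen hpos (by linarith)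
      (ZetaZeros.riemannZetaNontrivialZeros.zeta_eq_zero h)

/-! ## Wide bumps: `ε(a) ≤ M/a³` under RH -/

/-- **The dilated bump.** For a test function `φ` supported in `[-1, 1]` with `‖φ‖₂ = 1` and a window
`a ≥ 1`, the unitary dilate `g = weilDilate (1/a - 1) φ` (`g(t) = a^{-1/2} φ(t/a)`) is a test function
supported in `[-a, a]` with `‖g‖₂ = 1`, and under RH its Weil form is small:
`Re Q(g) ≤ (4 (∫‖φ''‖)² Σ_ρ m(ρ)/(1+γ²)²)/a³`. [folklore] -/
theorem re_weilQuadratic_weilDilate_le_of_RH (hRH : _root_.RiemannHypothesis) {φ : ℝ → ℂ}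
    (hφ : IsWeilTest φ) {a : ℝ} (ha : 1 ≤ a) :
    (weilQuadratic (weilDilate (1 / a - 1) φ)).re ≤
      4 * (∫ t : ℝ, ‖deriv (deriv φ) t‖) ^ 2 *
        (∑' ρ : ZetaZeros.riemannZetaNontrivialZeros, weilZeroWeight (ρ : ℂ)) / a ^ 3 := by
  have ha0 : 0 < a := lt_of_lt_of_le one_pos ha
  set η : ℝ := 1 / a - 1 with hηdef
  have hη : -1 < η := by
    have : 0 < 1 / a := one_div_pos.2 ha0
    rw [hηdef]
    linarith
  have h1η : 1 + η = 1 / a := by rw [hηdef]; ring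
  set D : ℝ := ∫ t : ℝ, ‖deriv (deriv φ) t‖ with hD
  have hD0 : 0 ≤ D := integral_nonneg fun _ ↦ norm_nonneg _
  set S : ℝ := ∑' ρ : ZetaZeros.riemannZetaNontrivialZeros, weilZeroWeight (ρ : ℂ) with hS
  have hg : IsWeilTest (weilDilate η φ) := hφ.weilDilate hη
  -- the bound on the zeros
  have key : ∀ ρ ∈ ZetaZeros.riemannZetaNontrivialZeros,
      Complex.normSq (weilMellin (weilDilate η φ) ρ) ≤ (4 * D ^ 2 / a ^ 3) / (1 + ρ.im ^ 2) ^ 2 := by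
    intro ρ hρ
    have hζ := ZetaZeros.riemannZetaNontrivialZeros.zeta_eq_zero hρ
    have him := ZetaZeros.riemannZetaNontrivialZeros.im_ne_zero hρ
    have hre : ρ.re = 1 / 2 := WeilWindowFlowStrictUnderRH.re_eq_half_of_RH hRH hζ him
    set u : ℝ := ρ.im with hu
    have hρeq : ρ = 1 / 2 + (u : ℂ) * I := by
      apply Complex.ext
      · simp [hre]
      · simp [hu]
    have hu1 : 1 ≤ |u| := one_le_abs_im_of_mem_nontrivialZeros hρ
    have hu2 : 1 ≤ u ^ 2 := by
      have h := hu1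
      rw [← sq_abs]
      nlinarith
    -- transform of the dilate at `ρ`
    have hpt : (1 / 2 : ℂ) + (1 / 2 + (u : ℂ) * I - 1 / 2) / ((1 + η : ℝ) : ℂ) =
        1 / 2 + ((a * u : ℝ) : ℂ) * I := by
      rw [h1η]
      have ha' : (a : ℂ) ≠ 0 := Complex.ofReal_ne_zero.2 ha0.ne'
      push_cast
      field_simp
      ring
    have hnorm : ‖weilMellin (weilDilate η φ) ρ‖ =
        Real.sqrt (1 / a) * a * ‖weilMellin φ (1 / 2 + ((a * u : ℝ) : ℂ) * I)‖ := by
      rw [hρeq, weilMellin_weilDilate φ hη, hpt, norm_mul, norm_mul, h1η, norm_inv,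
        Complex.norm_real, Complex.norm_real, Real.norm_eq_abs, Real.norm_eq_abs,
        abs_of_nonneg (Real.sqrt_nonneg _), abs_of_pos (one_div_pos.2 ha0), one_div, inv_inv]
    set N : ℝ := ‖weilMellin φ (1 / 2 + ((a * u : ℝ) : ℂ) * I)‖ with hN
    have hN0 : 0 ≤ N := norm_nonneg _
    have hparts : (a * u) ^ 2 * N ≤ D := by
      have h := sq_mul_norm_weilMellin_half_line_le hφ (a * u)
      simpa only [hN, hD] using h
    have hsq : Complex.normSq (weilMellin (weilDilate η φ) ρ) = a * N ^ 2 := by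
      rw [Complex.normSq_eq_norm_sq, hnorm, mul_pow, mul_pow, Real.sq_sqrt (one_div_pos.2 ha0).le]
      field_simp
    have hkey : a ^ 4 * u ^ 4 * N ^ 2 ≤ D ^ 2 := by
      have h0 : 0 ≤ (a * u) ^ 2 * N := by positivity
      calc a ^ 4 * u ^ 4 * N ^ 2 = ((a * u) ^ 2 * N) ^ 2 := by ring
        _ ≤ D ^ 2 := pow_le_pow_left₀ h0 hparts 2
    have hu4 : (1 + u ^ 2) ^ 2 ≤ 4 * u ^ 4 := by nlinarith
    have hpos : 0 < a ^ 3 * (1 + u ^ 2) ^ 2 := by positivity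
    rw [hsq, div_div, le_div_iff₀ hpos]
    calc a * N ^ 2 * (a ^ 3 * (1 + u ^ 2) ^ 2) = (a ^ 4 * N ^ 2) * (1 + u ^ 2) ^ 2 := by ring
      _ ≤ (a ^ 4 * N ^ 2) * (4 * u ^ 4) := mul_le_mul_of_nonneg_left hu4 (by positivity)
      _ = 4 * (a ^ 4 * u ^ 4 * N ^ 2) := by ring
      _ ≤ 4 * D ^ 2 := by linarith
  have hK : 0 ≤ 4 * D ^ 2 / a ^ 3 := by positivity
  have h := re_weilQuadratic_le_of_RH hRH hg hK key
  calc (weilQuadratic (weilDilate η φ)).re ≤ 4 * D ^ 2 / a ^ 3 * S := h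
    _ = 4 * D ^ 2 * S / a ^ 3 := by ring

/-- **Under RH the window bottom decays at least like `a⁻³`**: there is `M ≥ 0` with
`ε(a) ≤ M/a³` for every `a ≥ 1` (test the window with the dilated bump of
`re_weilQuadratic_weilDilate_le_of_RH`; `ε(a) ≤ Re Q(g)` for any admissible `g` on the unit sphere,
`bddBelow_weilQuadratic_sphere_holds`). The true decay is conjecturally doubly exponential
(arXiv:2106.01715 §2.5); `a⁻³` is what two integrations by parts give for free. [folklore] -/
theorem weilGroundEnergy_le_div_cube_of_RH (hRH : _root_.RiemannHypothesis) :
    ∃ M : ℝ, 0 ≤ M ∧ ∀ a : ℝ, 1 ≤ a → weilGroundEnergy a ≤ M / a ^ 3 := by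
  obtain ⟨φ, hφ, hsupp, hnorm⟩ := exists_isWeilTest_sphere one_pos
  set D : ℝ := ∫ t : ℝ, ‖deriv (deriv φ) t‖ with hD
  set S : ℝ := ∑' ρ : ZetaZeros.riemannZetaNontrivialZeros, weilZeroWeight (ρ : ℂ) with hS
  have hS0 : 0 ≤ S := tsum_nonneg fun ρ ↦ weilZeroWeight_nonneg ρ.2
  refine ⟨4 * D ^ 2 * S, by positivity, fun a ha ↦ ?_⟩
  have ha0 : 0 < a := lt_of_lt_of_le one_pos ha
  set η : ℝ := 1 / a - 1 with hηdef
  have hη : -1 < η := by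
    have : 0 < 1 / a := one_div_pos.2 ha0
    rw [hηdef]
    linarith
  have h1η : 1 + η = 1 / a := by rw [hηdef]; ring
  -- the dilate is admissible for the window `[-a, a]` and lies on the unit sphere
  have hg : IsWeilTest (weilDilate η φ) := hφ.weilDilate hη
  have hgsupp : tsupport (weilDilate η φ) ⊆ Icc (-a) a := by
    have h := tsupport_weilDilate_subset φ hη hsupp
    rwa [h1η, one_div_one_div] at h
  have hgnorm : ∫ t : ℝ, ‖weilDilate η φ t‖ ^ 2 = 1 := by
    rw [integral_norm_sq_weilDilate φ hη, hnorm]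
  have hle : weilGroundEnergy a ≤ (weilQuadratic (weilDilate η φ)).re :=
    csInf_le (bddBelow_weilQuadratic_sphere_holds a) ⟨_, hg, hgsupp, hgnorm, rfl⟩
  exact hle.trans (re_weilQuadratic_weilDilate_le_of_RH hRH hφ ha)

/-- **Under RH, for every `δ > 0` the bottom is eventually `< δ`**: `∃ a₀ > 0, ∀ a ≥ a₀, ε(a) < δ`.
[folklore] -/
theorem weilGroundEnergy_eventually_lt_of_RH (hRH : _root_.RiemannHypothesis) {δ : ℝ} (hδ : 0 < δ) :
    ∃ a₀ : ℝ, 0 < a₀ ∧ ∀ a : ℝ, a₀ ≤ a → weilGroundEnergy a < δ := by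
  obtain ⟨M, hM0, hM⟩ := weilGroundEnergy_le_div_cube_of_RH hRH
  refine ⟨max 1 (M / δ + 1), lt_max_of_lt_left one_pos, fun a ha ↦ ?_⟩
  have ha1 : 1 ≤ a := le_of_max_le_left ha
  have ha2 : M / δ + 1 ≤ a := le_of_max_le_right ha
  have ha0 : 0 < a := lt_of_lt_of_le one_pos ha1
  have h3 : a ≤ a ^ 3 := by
    calc a = a * 1 * 1 := by ring
      _ ≤ a * a * a := by gcongr
      _ = a ^ 3 := by ring
  have hMa : M / a ^ 3 ≤ M / a := div_le_div_of_nonneg_left hM0 ha0 h3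
  have hlt : M / a < δ := by
    rw [div_lt_iff₀ ha0]
    have h := (div_lt_iff₀ hδ).1 (show M / δ < a by linarith)
    linarith [mul_comm a δ]
  exact (hM a ha1).trans_lt (hMa.trans_lt hlt)

/-- **Under RH, `ε(a) → 0` as `a → +∞`** (`0 ≤ ε` under RH by the easy half of Weil's criterion and
`weilGroundEnergy_nonneg_iff_holds`; `ε ≤ M/a³` from above). So the Grönwall flow of route
WeilWindowFlow has NO uniform margin at `+∞` even when it never meets a conjugate point. [folklore] -/
theorem tendsto_weilGroundEnergy_atTop_of_RH (hRH : _root_.RiemannHypothesis) :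
    Tendsto weilGroundEnergy atTop (𝓝 0) := by
  obtain ⟨M, hM0, hM⟩ := weilGroundEnergy_le_div_cube_of_RH hRH
  have hup : Tendsto (fun a : ℝ ↦ M / a ^ 3) atTop (𝓝 0) := by
    have h := (tendsto_pow_atTop (n := 3) (α := ℝ) (by norm_num)).inv_tendsto_atTop.const_mul M
    simpa [div_eq_mul_inv] using h
  refine tendsto_of_tendsto_of_tendsto_of_le_of_le' tendsto_const_nhds hup ?_ ?_
  · filter_upwards [eventually_gt_atTop (0 : ℝ)] with a ha
    exact (weilGroundEnergy_nonneg_iff_holds ha).2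
      (WeilPositivityOn.of_riemannHypothesis explicit_formula_holds hRH a)
  · filter_upwards [eventually_ge_atTop (1 : ℝ)] with a ha
    exact hM a ha

/-! ## Unconditional consequences for the crux -/

/-- **The window bottom is not bounded away from `0` (unconditional).** For every `δ > 0` some window
has `ε(a) < δ`: under RH by `weilGroundEnergy_eventually_lt_of_RH`, without RH because some
`ε(a) < 0` (`exists_weilGroundEnergy_neg_of_not_riemannHypothesis`, Yoshida's criterion). This is the
disprover's near-miss `bottom_not_uniformly_positive_under_RH` (Cruxes/GronwallLeakage/Disproof.lean §6)
made a theorem, with no Dirichlet approximation. [folklore] -/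
theorem weilGroundEnergy_not_uniformly_positive :
    ∀ δ : ℝ, 0 < δ → ∃ a : ℝ, 0 < a ∧ weilGroundEnergy a < δ := by
  intro δ hδ
  by_cases hRH : _root_.RiemannHypothesis
  · obtain ⟨a₀, ha₀, h⟩ := weilGroundEnergy_eventually_lt_of_RH hRH hδ
    exact ⟨a₀, ha₀, h a₀ le_rfl⟩
  · obtain ⟨a, ha, hlt⟩ := exists_weilGroundEnergy_neg_of_not_riemannHypothesis hRH
    exact ⟨a, ha, hlt.trans hδ⟩

/-- Equivalent phrasing: there is no uniform positive margin `δ ≤ ε(a)` for all windows `a > 0`.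
[folklore] -/
theorem not_exists_uniform_margin :
    ¬ ∃ δ : ℝ, 0 < δ ∧ ∀ a : ℝ, 0 < a → δ ≤ weilGroundEnergy a := by
  rintro ⟨δ, hδ, hall⟩
  obtain ⟨a, ha, hlt⟩ := weilGroundEnergy_not_uniformly_positive δ hδ
  exact (lt_irrefl δ) ((hall a ha).trans_lt hlt)

/-- **TIGHTNESS OF THE CRUX AT `+∞`.** For every witness rate `C` of `GronwallLeakage` and every
`b > 0` the Grönwall integral diverges: `∫_b^a C → +∞` as `a → +∞`. Indeed a witness gives RH
(`gronwallLeakage_iff_riemannHypothesis`) and `ε > 0` (`weilGroundEnergy_pos_of_gronwallLeakage`),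
so `ε(a) → 0⁺` (`weilGroundEnergy_eventually_lt_of_RH`) while `ε(b) e^{-∫_b^a C} ≤ ε(a)`. Companion
of the landed tightness at `0⁺` (`gronwallLeakage_rate_not_intervalIntegrable_from_zero`): an
admissible rate is integrable at neither end of `(0, ∞)`. [folklore] -/
theorem gronwallLeakage_rate_integral_tendsto_atTop {C : ℝ → ℝ}
    (hC : ∀ b a : ℝ, 0 < b → b ≤ a → IntervalIntegrable C volume b a ∧
      weilGroundEnergy b * Real.exp (-(∫ x in b..a, C x)) ≤ weilGroundEnergy a)
    {b : ℝ} (hb : 0 < b) :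
    Tendsto (fun a ↦ ∫ x in b..a, C x) atTop atTop := by
  have hX : GronwallLeakage := ⟨C, hC⟩
  have hRH : _root_.RiemannHypothesis := gronwallLeakage_iff_riemannHypothesis.1 hX
  have hεb : 0 < weilGroundEnergy b := weilGroundEnergy_pos_of_gronwallLeakage hX hb
  refine tendsto_atTop.2 fun M ↦ ?_
  obtain ⟨a₀, -, ha₀⟩ :=
    weilGroundEnergy_eventually_lt_of_RH hRH (mul_pos hεb (Real.exp_pos (-M)))
  filter_upwards [eventually_ge_atTop (max a₀ b)] with a ha
  have hba : b ≤ a := le_of_max_le_right ha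
  have h1 : weilGroundEnergy b * Real.exp (-(∫ x in b..a, C x)) <
      weilGroundEnergy b * Real.exp (-M) :=
    ((hC b a hb hba).2).trans_lt (ha₀ a (le_of_max_le_left ha))
  have h2 : Real.exp (-(∫ x in b..a, C x)) < Real.exp (-M) := lt_of_mul_lt_mul_left h1 hεb.le
  have h3 := Real.exp_lt_exp.1 h2
  linarith

/-- **Refuted strengthening**: `GronwallLeakage` with a rate that is, in addition, integrable on some
half-line `(b, ∞)` is FALSE (its Grönwall integral would stay bounded by `∫_b^∞ |C|`). [folklore] -/
theorem gronwallLeakage_false_with_rate_integrable_at_top :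
    ¬ ∃ C : ℝ → ℝ, (∃ b : ℝ, 0 < b ∧ IntegrableOn C (Ioi b)) ∧
      ∀ b a : ℝ, 0 < b → b ≤ a → IntervalIntegrable C volume b a ∧
        weilGroundEnergy b * Real.exp (-(∫ x in b..a, C x)) ≤ weilGroundEnergy a := by
  rintro ⟨C, ⟨b, hb, hint⟩, hC⟩
  have htend := gronwallLeakage_rate_integral_tendsto_atTop hC hb
  have hbound : ∀ a : ℝ, b ≤ a → ∫ x in b..a, C x ≤ ∫ x in Ioi b, |C x| := by
    intro a hba
    have hint' : IntegrableOn (fun x ↦ |C x|) (Ioi b) := hint.abs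
    calc ∫ x in b..a, C x ≤ |∫ x in b..a, C x| := le_abs_self _
      _ ≤ ∫ x in b..a, |C x| := intervalIntegral.abs_integral_le_integral_abs hba
      _ = ∫ x in Ioc b a, |C x| := intervalIntegral.integral_of_le hba
      _ ≤ ∫ x in Ioi b, |C x| :=
          setIntegral_mono_set hint' (Eventually.of_forall fun x ↦ abs_nonneg (C x))
            (Eventually.of_forall Ioc_subset_Ioi_self)
  obtain ⟨a, ha⟩ := (htend.eventually_gt_atTop (∫ x in Ioi b, |C x|)).and
    (eventually_ge_atTop b) |>.exists
  exact (lt_irrefl _) ((hbound a ha.2).trans_lt ha.1)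

end Summit.RiemannHypothesis.RiemannHypothesis.Theorems.WeilWindowFlowGronwallLeakage

end
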